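import Summits.Ventures.PercRepro.RankLevelSetAvgAssembly
import Summits.Ventures.PercRepro.RankLevelSetNumGe

/-!
# PercRepro — THE AVERAGED (MC) IS UNCONDITIONAL ON THE WHOLE TIGHT LAYER FOR EVERY `q ≤ 10` (night-1, gen 10; dossier §20)

The binomial inequality `num_ge_le_ten` (RankLevelSetNumGe) discharges the one hypothesis of
`avg_contract_le_of_num` / `exists_slack_contract_le_of_num` (RankLevelSetAvgAssembly) at EVERY cell `(p,q)` with
`1 ≤ q ≤ 10`, `q + 2 ≤ p`: for every loopless matroid on `p + q` elements,
`Σ_e σ_{M／e}(p−1,q) ≤ |E|·σ_M(p,q)` and some `e` has `σ_{M／e}(p−1,q) ≤ σ_M(p,q)` — C-037's `(MC∃)` and its `(MC-2)`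
form, with no hypothesis beyond looplessness and no bound on `p` (the windows q = 4 / 5 / 6 of RankLevelSetAvgWindows
are the cases `p ≤ 16 / 30 / 38`; the gap windows q = 7 / 8 / 9 of record, `p ≤ 147 / 327 / 738`, are covered entirely).

Axioms: standard.
-/
open scoped Matroid

namespace PercRepro

open Set Finset

variable {α : Type} (M : Matroid α) [M.Finite]

/-- **THE AVERAGED (MC) ON THE TIGHT LAYER, UNCONDITIONAL, every `1 ≤ q ≤ 10`, every `p ≥ q + 2`**: for every loopless
matroid with `|E| = p + q`, `Σ_{e ∈ E} σ_{M／{e}}(p−1,q) ≤ |E|·σ_M(p,q)`. -/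
theorem avg_contract_le_le_ten (hl : ∀ e ∈ M.E, M.IsNonloop e) {p q : ℕ} (hq1 : 1 ≤ q) (hq : q ≤ 10)
    (hpq : q + 2 ≤ p) (hE : M.E.ncard = p + q) :
    ∑ e ∈ (M.set_finite M.E).toFinset, Matroid.slack (M ／ {e}) (p - 1) q ≤
      (M.E.ncard : ℚ) * Matroid.slack M p q :=
  avg_contract_le_of_num M hl hq1 hpq hE (num_ge_of_le_ten hq hpq)

/-- **C-037's `(MC∃)` ON THE TIGHT LAYER, UNCONDITIONAL, every `1 ≤ q ≤ 10`, every `p ≥ q + 2`**: every loopless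
matroid on `p + q` elements has an element `e` with `σ_{M／e}(p−1,q) ≤ σ_M(p,q)`. -/
theorem exists_slack_contract_le_le_ten (hl : ∀ e ∈ M.E, M.IsNonloop e) {p q : ℕ} (hq1 : 1 ≤ q) (hq : q ≤ 10)
    (hpq : q + 2 ≤ p) (hE : M.E.ncard = p + q) :
    ∃ e ∈ M.E, Matroid.slack (M ／ {e}) (p - 1) q ≤ Matroid.slack M p q :=
  exists_slack_contract_le_of_num M hl hq1 hpq hE (num_ge_of_le_ten hq hpq)

/-- The `(MC-2)` form: some `e` has `min(σ_{M／e}(p−1,q), σ_{M／e}(p−1,q−1)) ≤ σ_M(p,q)` (every `1 ≤ q ≤ 10`, `p ≥ q + 2`). -/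
theorem exists_contractMonoTwo_le_ten (hl : ∀ e ∈ M.E, M.IsNonloop e) {p q : ℕ} (hq1 : 1 ≤ q) (hq : q ≤ 10)
    (hpq : q + 2 ≤ p) (hE : M.E.ncard = p + q) :
    ∃ e ∈ M.E, min (Matroid.slack (M ／ {e}) (p - 1) q) (Matroid.slack (M ／ {e}) (p - 1) (q - 1)) ≤
      Matroid.slack M p q := by
  obtain ⟨e, he, h⟩ := exists_slack_contract_le_le_ten M hl hq1 hq hpq hE
  exact ⟨e, he, le_trans (min_le_left _ _) h⟩

end PercRepro
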